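import Mathlib
import HarnessLib
import Summits.Ventures.LatticeQCDFlow.Scaling.AutoregressiveGaugeHeatBathKL
import Summits.Ventures.LatticeQCDFlow.Scaling.PlaquettePeelingClosingBound

/-!
# LatticeQCDFlow / Scaling — the TRAINING-LOSS FLOOR of the heat-bath block model with a closing section:
# `KL(π ‖ q_B) ≥ s·log(M/M₂) − E_π[Σ_{p∉B} log(M/w(U_p))]`

HONEST FRAMING: exact (Metropolis-corrected) sampling algorithms for lattice gauge theory;
figures of merit are autocorrelation/cost numbers at stated couplings and volumes; no
continuum-physics claim.

Venture `LatticeQCDFlow` (cell pub-lqcd), topic `Scaling`, FANOUT row 30 (lean-1, GEN-26) — OUR WORK on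
THEORY-2.md §4 row C5.  GEN-24's `Scaling/AutoregressiveGaugeHeatBathKL` bounded the training loss of the
block law `q_B = (F_B/Z_B)·Haar^{⊗E}` against the full target `π = (F/Z)·Haar^{⊗E}` from ABOVE:
`KL(π ‖ q_B) ≤ k·log(M/m)`, `k = #Bᶜ`, through the squeeze `Z/Z_B ∈ [m^k, M^k]`.  With the sharper
`Z/Z_B ≤ M^{k−s} M₂^{s}` of `Scaling/PlaquettePeelingClosingBound` (`(B, t, rank)` ranked with a closing
section `(S, u)` of size `s`; `M₂` the two-plaquette constant) the loss is bounded from BELOW: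

* **`log_density_ratio_ge`** — pointwise, `log((F(U)/Z)/(F_B(U)/Z_B)) ≥ s·log(M/M₂) − Σ_{p∉B} log(M/w(U_p))`;
* **`kl_blockLaw_ge`** — `KL(π ‖ q_B) ≥ s·log(M/M₂) − ∫ (F/Z)·Σ_{p∉B} log(M/w(U_p)) dHaar^{⊗E}`: the loss of
  the exact one-plaquette heat-bath model is EXTENSIVE (`≥ (s/k)·log(M/M₂) − δ̄` per uncovered plaquette)
  unless the target's mean log-defect per uncovered plaquette `δ̄ = k⁻¹ E_π[Σ_{p∉B} log(M/w(U_p))]` exceeds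
  `(s/k)·log(M/M₂)` — with `s ≥ k/(2d−3)` for the optimal structures (`TorusClosingSection`).

NOT CLAIMED: the sign of `(s/k)·log(M/M₂) − δ̄` for any weight, coupling or dimension (`δ̄` is a
property of the target; at weak coupling both terms are of order one per plaquette).  No `def`, no `sorry`,
nothing cited as a fact.
-/

noncomputable section

namespace Summit.Ventures.LatticeQCDFlow.Theory2.Autoregressive

open MeasureTheory Function Finset
open Literature.MathematicalPhysics.QuantumFieldTheory Literature.MathematicalPhysics.QuantumLattice
open Summit.Ventures.LatticeQCDFlow.Exactness Summit.Ventures.LatticeQCDFlow.Scoring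

variable {d L : ℕ} [NeZero L] {G : Type*} [Group G] [TopologicalSpace G] [IsTopologicalGroup G]
  [CompactSpace G] [SecondCountableTopology G] [MeasurableSpace G] [BorelSpace G]

/-- **Pointwise: `log((F/Z)/(F_B/Z_B)) ≥ s·log(M/M₂) − Σ_{p∉B} log(M/w(U_p))`** for a ranked structure with a
closing section of size `s` (`L ≥ 2`; `w` continuous, `0 < m ≤ w ≤ M`; `∫ w(h) w(a h^{±1} b) dHaar ≤ c·M₂`):
the ratio is `F_R(U)·Z_B/Z` and `Z/Z_B ≤ M^{k−s} M₂^{s}`. [ours] -/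
theorem log_density_ratio_ge (hL : 2 ≤ L) {w : G → ℝ} (hw : Continuous w) {m M : ℝ} (hm0 : 0 < m)
    (hm : ∀ g, m ≤ w g) (hM : ∀ g, w g ≤ M) {M₂ : ℝ}
    (hM₂ : ∀ a b : G, ∫ h, w h * w (a * h * b) ∂(haarProbability G) ≤
      (∫ g, w g ∂(haarProbability G)) * M₂)
    (hM₂' : ∀ a b : G, ∫ h, w h * w (a * h⁻¹ * b) ∂(haarProbability G) ≤
      (∫ g, w g ∂(haarProbability G)) * M₂)
    (B : Finset (Plaquette d L)) (t : Plaquette d L → Edge d L)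
    (ht : ∀ p ∈ B, t p ∈ ({(p.1, p.2.1.1), (p.1.shift p.2.1.1, p.2.1.2),
        (p.1.shift p.2.1.2, p.2.1.1), (p.1, p.2.1.2)} : Finset (Edge d L)))
    (rank : Plaquette d L → ℕ)
    (hrank : ∀ p ∈ B, ∀ p' ∈ B, p ≠ p' → t p ∈ ({(p'.1, p'.2.1.1), (p'.1.shift p'.2.1.1, p'.2.1.2),
        (p'.1.shift p'.2.1.2, p'.2.1.1), (p'.1, p'.2.1.2)} : Finset (Edge d L)) → rank p < rank p')
    (S : Finset (Plaquette d L)) (u : Plaquette d L → Plaquette d L) (hSB : ∀ p' ∈ S, p' ∉ B)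
    (huB : ∀ p' ∈ S, u p' ∈ B)
    (hut : ∀ p' ∈ S, t (u p') ∈ ({(p'.1, p'.2.1.1), (p'.1.shift p'.2.1.1, p'.2.1.2),
        (p'.1.shift p'.2.1.2, p'.2.1.1), (p'.1, p'.2.1.2)} : Finset (Edge d L)))
    (humax : ∀ p' ∈ S, ∀ p ∈ B, p ≠ u p' → t p ∈ ({(p'.1, p'.2.1.1), (p'.1.shift p'.2.1.1, p'.2.1.2),
        (p'.1.shift p'.2.1.2, p'.2.1.1), (p'.1, p'.2.1.2)} : Finset (Edge d L)) → rank p < rank (u p'))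
    (huinj : Set.InjOn u S) (U : GaugeConfig d L G) :
    S.card * Real.log (M / M₂) -
        ∑ p ∈ Finset.univ \ B, Real.log (M / w (plaquetteHolonomy U p.1 p.2.1.1 p.2.1.2)) ≤
      Real.log (((∏ p : Plaquette d L, w (plaquetteHolonomy U p.1 p.2.1.1 p.2.1.2)) /
            ∫ V, ∏ p : Plaquette d L, w (plaquetteHolonomy V p.1 p.2.1.1 p.2.1.2)
              ∂(Measure.pi fun _ : Edge d L => haarProbability G)) /
          ((∏ p ∈ B, w (plaquetteHolonomy U p.1 p.2.1.1 p.2.1.2)) /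
            ∫ V, ∏ p ∈ B, w (plaquetteHolonomy V p.1 p.2.1.1 p.2.1.2)
              ∂(Measure.pi fun _ : Edge d L => haarProbability G))) := by
  set Haar : Measure (GaugeConfig d L G) := Measure.pi fun _ : Edge d L => haarProbability G with hHaar
  set FT : GaugeConfig d L G → ℝ := fun U => ∏ p : Plaquette d L, w (plaquetteHolonomy U p.1 p.2.1.1 p.2.1.2)
    with hFT
  set FB : GaugeConfig d L G → ℝ := fun U => ∏ p ∈ B, w (plaquetteHolonomy U p.1 p.2.1.1 p.2.1.2) with hFB
  set FR : GaugeConfig d L G → ℝ := fun U => ∏ p ∈ Finset.univ \ B, w (plaquetteHolonomy U p.1 p.2.1.1 p.2.1.2)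
    with hFR
  set ZT : ℝ := ∫ V, FT V ∂Haar with hZT
  set ZB : ℝ := ∫ V, FB V ∂Haar with hZB
  set k : ℕ := (Finset.univ \ B).card with hk
  set s : ℕ := S.card with hs
  have hw0 : ∀ g, 0 < w g := fun g => hm0.trans_le (hm g)
  have hMpos : 0 < M := (hw0 1).trans_le (hM 1)
  haveI : IsProbabilityMeasure Haar := by rw [hHaar]; infer_instance
  have hc : 0 < ∫ g, w g ∂(haarProbability G) := haarProbability_integral_pos_of_continuous_pos hw hw0
  have hFTc : Continuous FT := continuous_prodPlaquetteWeight_anyDim hw Finset.univ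
  have hFTpos : ∀ U, 0 < FT U := fun U => prod_pos fun p _ => hw0 _
  have hFBpos : ∀ U, 0 < FB U := fun U => prod_pos fun p _ => hw0 _
  have hFRpos : ∀ U, 0 < FR U := fun U => prod_pos fun p _ => hw0 _
  have hFTi : Integrable FT Haar := by
    refine Integrable.mono' (integrable_const (M ^ (Finset.univ : Finset (Plaquette d L)).card))
      hFTc.aestronglyMeasurable (ae_of_all _ fun U => ?_)
    rw [Real.norm_eq_abs, abs_of_pos (hFTpos U)]
    exact (pow_le_prodPlaquetteWeight_le_pow_anyDim hm0 hm hM _ U).2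
  have hZTpos : 0 < ZT := by
    have h := integral_mono (integrable_const (m ^ (Finset.univ : Finset (Plaquette d L)).card)) hFTi
      fun U => (pow_le_prodPlaquetteWeight_le_pow_anyDim hm0 hm hM _ U).1
    rw [integral_const, smul_eq_mul, probReal_univ, one_mul] at h
    exact lt_of_lt_of_le (pow_pos hm0 _) h
  have hZB' : ZB = (∫ g, w g ∂(haarProbability G)) ^ B.card :=
    integral_prod_weight_eq_pow_of_rank (G := G) hL hw hm0 hm hM B t ht rank hrank
  have hZBpos : 0 < ZB := by rw [hZB']; exact pow_pos hc _
  -- `M₂ > 0`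
  have hM₂pos : 0 < M₂ := by
    have h1 := hM₂ 1 1
    have h0 : 0 < ∫ h, w h * w (1 * h * 1) ∂(haarProbability G) := by
      have hi : Integrable (fun h : G => w h * w (1 * h * 1)) (haarProbability G) :=
        Literature.Probability.LatticeModels.integrable_of_continuous_compactSpace _
          (hw.mul (hw.comp ((continuous_const.mul continuous_id).mul continuous_const)))
      have h := integral_mono (integrable_const (m * m)) hi fun h => by
        exact mul_le_mul (hm _) (hm _) hm0.le (hw0 _).le
      rw [integral_const, smul_eq_mul, probReal_univ, one_mul] at h
      exact lt_of_lt_of_le (mul_pos hm0 hm0) h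
    exact (mul_pos_iff_of_pos_left hc).1 (h0.trans_le h1)
  -- the closing-section bound, with `s ≤ k`
  have hSsub : S ⊆ Finset.univ \ B := fun p' hp' => Finset.mem_sdiff.2 ⟨Finset.mem_univ _, hSB p' hp'⟩
  have hsk : s ≤ k := Finset.card_le_card hSsub
  have hdiv : ZT / ZB ≤ M ^ (k - s) * M₂ ^ s :=
    integral_prod_weight_div_le_of_closing (G := G) hL hw hm0 hm hM hM₂ hM₂' B t ht rank hrank S u hSB
      huB hut humax huinj
  -- the ratio is `F_R · Z_B/Z`
  have hsplit : FT U = FR U * FB U := (Finset.prod_sdiff (Finset.subset_univ B)).symm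
  have hratio : FT U / ZT / (FB U / ZB) = FR U / (ZT / ZB) := by
    have hFB0 : FB U ≠ 0 := (hFBpos U).ne'
    rw [hsplit]
    field_simp
  have hlogratio : Real.log (FT U / ZT / (FB U / ZB)) = Real.log (FR U) - Real.log (ZT / ZB) := by
    rw [hratio, Real.log_div (hFRpos U).ne' (div_pos hZTpos hZBpos).ne']
  have hlogFR : Real.log (FR U) = ∑ p ∈ Finset.univ \ B, Real.log (w (plaquetteHolonomy U p.1 p.2.1.1 p.2.1.2)) := by
    rw [hFR]; exact Real.log_prod (fun p _ => (hw0 _).ne')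
  have hlogZ : Real.log (ZT / ZB) ≤ ((k : ℝ) - s) * Real.log M + s * Real.log M₂ := by
    have h1 : Real.log (ZT / ZB) ≤ Real.log (M ^ (k - s) * M₂ ^ s) :=
      Real.log_le_log (div_pos hZTpos hZBpos) hdiv
    rw [Real.log_mul (pow_ne_zero _ hMpos.ne') (pow_ne_zero _ hM₂pos.ne'), Real.log_pow, Real.log_pow,
      Nat.cast_sub hsk] at h1
    exact h1
  have hsumlog : ∑ p ∈ Finset.univ \ B, Real.log (M / w (plaquetteHolonomy U p.1 p.2.1.1 p.2.1.2)) =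
      k * Real.log M - ∑ p ∈ Finset.univ \ B, Real.log (w (plaquetteHolonomy U p.1 p.2.1.1 p.2.1.2)) := by
    rw [Finset.sum_congr rfl fun p _ => Real.log_div hMpos.ne' (hw0 _).ne', Finset.sum_sub_distrib,
      Finset.sum_const, nsmul_eq_mul, hk]
  have hlogMM : Real.log (M / M₂) = Real.log M - Real.log M₂ := Real.log_div hMpos.ne' hM₂pos.ne'
  show (s : ℝ) * Real.log (M / M₂) -
      ∑ p ∈ Finset.univ \ B, Real.log (M / w (plaquetteHolonomy U p.1 p.2.1.1 p.2.1.2)) ≤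
    Real.log (FT U / ZT / (FB U / ZB))
  rw [hlogratio, hlogFR, hsumlog, hlogMM]
  linarith

/-- **THE TRAINING-LOSS FLOOR: `KL(π ‖ q_B) ≥ s·log(M/M₂) − ∫ (F/Z)·Σ_{p∉B} log(M/w(U_p)) dHaar^{⊗E}`.**
Same setting; the Kullback–Leibler divergence written, as in `kl_blockLaw_le`, as the integral of
`(F/Z)·log((F/Z)/(F_B/Z_B))` against `Haar^{⊗E}`. [ours] -/
theorem kl_blockLaw_ge (hL : 2 ≤ L) {w : G → ℝ} (hw : Continuous w) {m M : ℝ} (hm0 : 0 < m)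
    (hm : ∀ g, m ≤ w g) (hM : ∀ g, w g ≤ M) {M₂ : ℝ}
    (hM₂ : ∀ a b : G, ∫ h, w h * w (a * h * b) ∂(haarProbability G) ≤
      (∫ g, w g ∂(haarProbability G)) * M₂)
    (hM₂' : ∀ a b : G, ∫ h, w h * w (a * h⁻¹ * b) ∂(haarProbability G) ≤
      (∫ g, w g ∂(haarProbability G)) * M₂)
    (B : Finset (Plaquette d L)) (t : Plaquette d L → Edge d L)
    (ht : ∀ p ∈ B, t p ∈ ({(p.1, p.2.1.1), (p.1.shift p.2.1.1, p.2.1.2),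
        (p.1.shift p.2.1.2, p.2.1.1), (p.1, p.2.1.2)} : Finset (Edge d L)))
    (rank : Plaquette d L → ℕ)
    (hrank : ∀ p ∈ B, ∀ p' ∈ B, p ≠ p' → t p ∈ ({(p'.1, p'.2.1.1), (p'.1.shift p'.2.1.1, p'.2.1.2),
        (p'.1.shift p'.2.1.2, p'.2.1.1), (p'.1, p'.2.1.2)} : Finset (Edge d L)) → rank p < rank p')
    (S : Finset (Plaquette d L)) (u : Plaquette d L → Plaquette d L) (hSB : ∀ p' ∈ S, p' ∉ B)
    (huB : ∀ p' ∈ S, u p' ∈ B)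
    (hut : ∀ p' ∈ S, t (u p') ∈ ({(p'.1, p'.2.1.1), (p'.1.shift p'.2.1.1, p'.2.1.2),
        (p'.1.shift p'.2.1.2, p'.2.1.1), (p'.1, p'.2.1.2)} : Finset (Edge d L)))
    (humax : ∀ p' ∈ S, ∀ p ∈ B, p ≠ u p' → t p ∈ ({(p'.1, p'.2.1.1), (p'.1.shift p'.2.1.1, p'.2.1.2),
        (p'.1.shift p'.2.1.2, p'.2.1.1), (p'.1, p'.2.1.2)} : Finset (Edge d L)) → rank p < rank (u p'))
    (huinj : Set.InjOn u S) :
    S.card * Real.log (M / M₂) -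
        ∫ U, (∏ p : Plaquette d L, w (plaquetteHolonomy U p.1 p.2.1.1 p.2.1.2)) /
            (∫ V, ∏ p : Plaquette d L, w (plaquetteHolonomy V p.1 p.2.1.1 p.2.1.2)
              ∂(Measure.pi fun _ : Edge d L => haarProbability G)) *
          ∑ p ∈ Finset.univ \ B, Real.log (M / w (plaquetteHolonomy U p.1 p.2.1.1 p.2.1.2))
          ∂(Measure.pi fun _ : Edge d L => haarProbability G) ≤
      ∫ U, (∏ p : Plaquette d L, w (plaquetteHolonomy U p.1 p.2.1.1 p.2.1.2)) /
            (∫ V, ∏ p : Plaquette d L, w (plaquetteHolonomy V p.1 p.2.1.1 p.2.1.2)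
              ∂(Measure.pi fun _ : Edge d L => haarProbability G)) *
          Real.log (((∏ p : Plaquette d L, w (plaquetteHolonomy U p.1 p.2.1.1 p.2.1.2)) /
              ∫ V, ∏ p : Plaquette d L, w (plaquetteHolonomy V p.1 p.2.1.1 p.2.1.2)
                ∂(Measure.pi fun _ : Edge d L => haarProbability G)) /
            ((∏ p ∈ B, w (plaquetteHolonomy U p.1 p.2.1.1 p.2.1.2)) /
              ∫ V, ∏ p ∈ B, w (plaquetteHolonomy V p.1 p.2.1.1 p.2.1.2)
                ∂(Measure.pi fun _ : Edge d L => haarProbability G)))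
          ∂(Measure.pi fun _ : Edge d L => haarProbability G) := by
  set Haar : Measure (GaugeConfig d L G) := Measure.pi fun _ : Edge d L => haarProbability G with hHaar
  set FT : GaugeConfig d L G → ℝ := fun U => ∏ p : Plaquette d L, w (plaquetteHolonomy U p.1 p.2.1.1 p.2.1.2)
    with hFT
  set ZT : ℝ := ∫ V, FT V ∂Haar with hZT
  set k : ℕ := (Finset.univ \ B).card with hk
  set D : GaugeConfig d L G → ℝ := fun U =>
    ∑ p ∈ Finset.univ \ B, Real.log (M / w (plaquetteHolonomy U p.1 p.2.1.1 p.2.1.2)) with hD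
  have hw0 : ∀ g, 0 < w g := fun g => hm0.trans_le (hm g)
  have hMpos : 0 < M := (hw0 1).trans_le (hM 1)
  haveI : IsProbabilityMeasure Haar := by rw [hHaar]; infer_instance
  have hFTc : Continuous FT := continuous_prodPlaquetteWeight_anyDim hw Finset.univ
  have hFTpos : ∀ U, 0 < FT U := fun U => prod_pos fun p _ => hw0 _
  have hFTle : ∀ U, FT U ≤ M ^ (Finset.univ : Finset (Plaquette d L)).card := fun U =>
    (pow_le_prodPlaquetteWeight_le_pow_anyDim hm0 hm hM _ U).2
  have hFTi : Integrable FT Haar := by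
    refine Integrable.mono' (integrable_const (M ^ (Finset.univ : Finset (Plaquette d L)).card))
      hFTc.aestronglyMeasurable (ae_of_all _ fun U => ?_)
    rw [Real.norm_eq_abs, abs_of_pos (hFTpos U)]
    exact hFTle U
  have hZTpos : 0 < ZT := by
    have h := integral_mono (integrable_const (m ^ (Finset.univ : Finset (Plaquette d L)).card)) hFTi
      fun U => (pow_le_prodPlaquetteWeight_le_pow_anyDim hm0 hm hM _ U).1
    rw [integral_const, smul_eq_mul, probReal_univ, one_mul] at h
    exact lt_of_lt_of_le (pow_pos hm0 _) h
  have hnorm : ∫ U, FT U / ZT ∂Haar = 1 := by rw [integral_div, div_self hZTpos.ne']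
  have hdens0 : ∀ U, 0 ≤ FT U / ZT := fun U => div_nonneg (hFTpos U).le hZTpos.le
  -- the defect sum is continuous and bounded
  have hDc : Continuous D := by
    refine continuous_finsetSum _ fun p _ => ?_
    exact (continuous_const.div (hw.comp (continuous_config_plaquetteHolonomy p.1 p.2.1.1 p.2.1.2))
      fun U => (hw0 _).ne').log fun U => (div_pos hMpos (hw0 _)).ne'
  have hDb : ∀ U, |D U| ≤ k * Real.log (M / m) := by
    intro U
    have hterm : ∀ p ∈ Finset.univ \ B,
        |Real.log (M / w (plaquetteHolonomy U p.1 p.2.1.1 p.2.1.2))| ≤ Real.log (M / m) := by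
      intro p _
      have h0 : 0 ≤ Real.log (M / w (plaquetteHolonomy U p.1 p.2.1.1 p.2.1.2)) :=
        Real.log_nonneg ((one_le_div (hw0 _)).2 (hM _))
      rw [abs_of_nonneg h0]
      exact Real.log_le_log (div_pos hMpos (hw0 _)) (div_le_div_of_nonneg_left hMpos.le hm0 (hm _))
    calc |D U| ≤ ∑ p ∈ Finset.univ \ B, |Real.log (M / w (plaquetteHolonomy U p.1 p.2.1.1 p.2.1.2))| :=
          Finset.abs_sum_le_sum_abs _ _
      _ ≤ ∑ p ∈ Finset.univ \ B, Real.log (M / m) := Finset.sum_le_sum hterm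
      _ = k * Real.log (M / m) := by rw [Finset.sum_const, nsmul_eq_mul, hk]
  have hDi : Integrable (fun U => FT U / ZT * D U) Haar := by
    refine Integrable.mono' ((hFTi.div_const ZT).norm.mul_const (k * Real.log (M / m)))
      ((hFTc.div_const ZT).mul hDc).aestronglyMeasurable (ae_of_all _ fun U => ?_)
    rw [Real.norm_eq_abs, abs_mul, Real.norm_eq_abs]
    exact mul_le_mul_of_nonneg_left (hDb U) (abs_nonneg _)
  -- the KL integrand is integrable (bounded log-ratio, GEN-24's §1)
  have hlogm : Measurable fun U : GaugeConfig d L G => Real.log (FT U / ZT /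
      ((∏ p ∈ B, w (plaquetteHolonomy U p.1 p.2.1.1 p.2.1.2)) /
        ∫ V, ∏ p ∈ B, w (plaquetteHolonomy V p.1 p.2.1.1 p.2.1.2) ∂Haar)) :=
    ((hFTc.measurable.div_const ZT).div
      ((continuous_prodPlaquetteWeight_anyDim hw B).measurable.div_const _)).log
  have hKLi : Integrable (fun U => FT U / ZT * Real.log (FT U / ZT /
      ((∏ p ∈ B, w (plaquetteHolonomy U p.1 p.2.1.1 p.2.1.2)) /
        ∫ V, ∏ p ∈ B, w (plaquetteHolonomy V p.1 p.2.1.1 p.2.1.2) ∂Haar))) Haar := by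
    refine Integrable.mono' ((hFTi.div_const ZT).norm.mul_const (k * Real.log (M / m)))
      ((hFTc.measurable.div_const ZT).mul hlogm).aestronglyMeasurable (ae_of_all _ fun U => ?_)
    rw [Real.norm_eq_abs, abs_mul, Real.norm_eq_abs]
    exact mul_le_mul_of_nonneg_left (log_density_ratio_abs_le (G := G) hw hm0 hm hM B U) (abs_nonneg _)
  -- pointwise, multiply the floor by the density and integrate
  have hpt : ∀ U, FT U / ZT * (S.card * Real.log (M / M₂) - D U) ≤
      FT U / ZT * Real.log (FT U / ZT /
        ((∏ p ∈ B, w (plaquetteHolonomy U p.1 p.2.1.1 p.2.1.2)) /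
          ∫ V, ∏ p ∈ B, w (plaquetteHolonomy V p.1 p.2.1.1 p.2.1.2) ∂Haar)) := fun U =>
    mul_le_mul_of_nonneg_left (log_density_ratio_ge (G := G) hL hw hm0 hm hM hM₂ hM₂' B t ht rank hrank S u
      hSB huB hut humax huinj U) (hdens0 U)
  have hlhs : ∫ U, FT U / ZT * (S.card * Real.log (M / M₂) - D U) ∂Haar =
      S.card * Real.log (M / M₂) - ∫ U, FT U / ZT * D U ∂Haar := by
    have e : ∀ U, FT U / ZT * (S.card * Real.log (M / M₂) - D U) =
        FT U / ZT * (S.card * Real.log (M / M₂)) - FT U / ZT * D U := fun U => by ring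
    simp_rw [e]
    rw [integral_sub ((hFTi.div_const ZT).mul_const _) hDi, integral_mul_const, hnorm, one_mul]
  calc (S.card : ℝ) * Real.log (M / M₂) - ∫ U, FT U / ZT * D U ∂Haar
      = ∫ U, FT U / ZT * (S.card * Real.log (M / M₂) - D U) ∂Haar := hlhs.symm
    _ ≤ _ := integral_mono (by
        have e : ∀ U, FT U / ZT * (S.card * Real.log (M / M₂) - D U) =
            FT U / ZT * (S.card * Real.log (M / M₂)) - FT U / ZT * D U := fun U => by ring
        simp_rw [e]
        exact ((hFTi.div_const ZT).mul_const _).sub hDi) hKLi hpt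

end Summit.Ventures.LatticeQCDFlow.Theory2.Autoregressive

end
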